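import Literature.NumberTheory.GaloisRepresentations.ContinuousH1OrderTwo
import Literature.NumberTheory.GaloisRepresentations.ContinuousH2
import Literature.NumberTheory.GaloisRepresentations.AbsGaloisGroupCompact
import HarnessLib

/-!
# `2 · H²(G, X) = 0` for a group of order `≤ 2`; `n · H²(G, X) = 0` when `n · X = 0`; archimedean places

Topic `NumberTheory/GaloisRepresentations`; namespace `Literature.NumberTheory.GaloisRepresentations`.
Theorems only: **no named fact is introduced** (D-0026).  Degree-`2` twin of `ContinuousH1OrderTwo.lean`.

For a topological group `G` of order `≤ 2` and ANY topological representation `X` of `G`, the continuous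
cohomology group `H²(G, X)` (Mathlib `continuousCohomology 2`, described by continuous inhomogeneous
`2`-cocycles in the tree's `ContinuousH2.lean`) is killed by `2`
(`two_nsmul_continuousCohomology_two_eq_zero_of_natCard_le_two`): for a `2`-cocycle `f` the `1`-cochain
`b(σ) = f(σ, σ) + f(1, 1)` has coboundary `2 f` — at `(1, τ)`, `(σ, 1)` by the normalisations
`f(1, τ) = f(1, 1)`, `f(σ, 1) = σ f(1, 1)`, and at `(c, c)` (`c² = 1`) by the cocycle identity
`c f(c, c) + f(c, 1) = f(1, c) + f(c, c)`.  (Serre, *Galois Cohomology*, I §2.4, Cor. of Prop. 9: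
`#G · Hⁿ(G, X) = 0`; case `#G ∣ 2`, `n = 2`, by direct cocycle computation — `H²(ℤ/2, X) = X^c/(1 + c)X`.)
Hence odd-torsion classes of `H²(G, X)` vanish (`eq_zero_of_odd_nsmul_continuousCohomology_two_of_natCard_le_two`).
Also recorded: `n · H²(G, X) = 0` whenever `n · X = 0` (`nsmul_continuousCohomology_two_eq_zero_of_forall`,
the degree-`2` twin of the tree's `galoisCohomology.nsmul_eq_zero_of_forall`).

Application at an infinite place `w` of a number field (`Γ_{K_w}` has order `≤ 2`,
`natCard_absoluteGaloisGroup_completion_infinitePlace_le_two`): `2 · H²(K_w, X) = 0`, odd-torsion classes of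
`H²(K_w, X)` vanish, and **`H²(K_w, M) = 0` for a discrete `Γ_K`-module `M` killed by an ODD integer**
(`galoisCohomology_two_toLocal_inl_eq_zero_of_odd`) — so at odd primes `p` the archimedean places impose no
condition in degree `2` either (Milne, *ADT*, I Rem. 3.7: the groups `H^r(ℝ, M)` are killed by `2`).  Consumer:
the odd-`p` vanishing of `Ш²(K, E[p^∞])` (crux K4 `SignedControlAtTwo` inputs seat; Greenberg LNM 1716 Prop. 4.12
elimination at odd `p`).

## References

* [SerreGaloisCohomology1997] J.-P. Serre, *Galois Cohomology* (1997), I §2.3 (continuous factor systems),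
  I §2.4 (Prop. 9 and corollaries: `Card(G) · Hⁿ(G, A) = 0` for finite `G`).
* [MilneADT2006] J. S. Milne, *Arithmetic Duality Theorems*, 2nd ed. (2006), I Rem. 3.7.
-/

noncomputable section

universe u v

namespace Literature.NumberTheory.GaloisRepresentations

open _root_.TopRep Function Field NumberField

/-! ## Groups of order `≤ 2` -/

section OrderTwo

variable {R : Type u} [CommRing R] [TopologicalSpace R]
variable {G : Type v} [Group G] [TopologicalSpace G] [IsTopologicalGroup G]

/-- **`n · X = 0 ⟹ n · H²(G, X) = 0`**: every class is the class of a continuous `2`-cocycle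
(`twoCocycleClass_surjective`), and `n · f = 0` pointwise. Degree-`2` twin of
`galoisCohomology.nsmul_eq_zero_of_forall`. [cite: SerreGaloisCohomology1997, I §2.3] -/
theorem nsmul_continuousCohomology_two_eq_zero_of_forall [CompactSpace G] [T2Space G]
    [TotallyDisconnectedSpace G] (X : TopRep.{v} R G) {n : ℕ} (hX : ∀ x : X, n • x = 0)
    (c : continuousCohomology 2 X) : n • c = 0 := by
  obtain ⟨f, rfl⟩ := twoCocycleClass_surjective X c
  have hf : ((n : ℕ) : R) • f = 0 := by
    refine Subtype.ext (ContinuousMap.ext fun στ => ?_)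
    change ((n : ℕ) : R) • f.1 στ = 0
    rw [Nat.cast_smul_eq_nsmul]
    exact hX _
  rw [← Nat.cast_smul_eq_nsmul R, ← twoCocycleClass_smul, hf, twoCocycleClass_zero]

/-- **`2 · H²(G, X) = 0` for a group `G` of order `≤ 2`** and any topological representation `X`: for a
continuous `2`-cocycle `f`, the continuous `1`-cochain `b(σ) = f(σ, σ) + f(1, 1)` satisfies
`2 f(σ, τ) = σ b(τ) - b(στ) + b(σ)` — by `f(1, τ) = f(1, 1)`, `f(σ, 1) = σ f(1, 1)` when `σ = 1` or `τ = 1`, and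
by the cocycle identity at `(c, c, c)` with `c² = 1` when `σ = τ = c`.
Serre, *Galois Cohomology*, I §2.4 (Cor. of Prop. 9, `#G · Hⁿ(G, X) = 0`, case `#G ∣ 2`, `n = 2`).
[cite: SerreGaloisCohomology1997, I §2.4] -/
theorem two_nsmul_continuousCohomology_two_eq_zero_of_natCard_le_two [Finite G]
    (hG : Nat.card G ≤ 2) (X : TopRep.{v} R G) (x : continuousCohomology 2 X) : 2 • x = 0 := by
  obtain ⟨f, rfl⟩ := twoCocycleClass_surjective X x
  rw [← Nat.cast_smul_eq_nsmul R, ← twoCocycleClass_smul, twoCocycleClass_eq_zero_iff]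
  -- the `1`-cochain `b(σ) = f(σ, σ) + f(1, 1)`
  refine ⟨⟨fun σ => f.1 (σ, σ) + f.1 (1, 1),
    (f.1.continuous.comp (continuous_id.prodMk continuous_id)).add continuous_const⟩, fun σ τ => ?_⟩
  change ((2 : ℕ) : R) • f.1 (σ, τ) =
    X.ρ σ (f.1 (τ, τ) + f.1 (1, 1)) - (f.1 (σ * τ, σ * τ) + f.1 (1, 1)) + (f.1 (σ, σ) + f.1 (1, 1))
  rw [Nat.cast_smul_eq_nsmul, two_nsmul]
  rcases eq_or_ne σ 1 with rfl | hσ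
  · -- `σ = 1`: `f(1, τ) = f(1, 1)`
    rw [contTwoCocycles.apply_one_left f τ, _root_.map_one X.ρ, one_mul]
    change f.1 (1, 1) + f.1 (1, 1) =
      (f.1 (τ, τ) + f.1 (1, 1)) - (f.1 (τ, τ) + f.1 (1, 1)) + (f.1 (1, 1) + f.1 (1, 1))
    abel
  rcases eq_or_ne τ 1 with rfl | hτ
  · -- `τ = 1`: `f(σ, 1) = σ f(1, 1)`
    rw [contTwoCocycles.apply_one_right f σ, mul_one, map_add]
    abel
  · -- `σ = τ = c`, `c * c = 1`: the cocycle identity at `(c, c, c)`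
    obtain rfl : σ = τ := eq_of_ne_one_of_natCard_le_two hG hσ hτ
    have hcc : σ * σ = 1 := mul_self_eq_one_of_natCard_le_two hG σ
    have hcyc := f.2 σ σ σ
    rw [hcc, contTwoCocycles.apply_one_left f σ, contTwoCocycles.apply_one_right f σ] at hcyc
    -- `hcyc : σ f(σ,σ) + σ f(1,1) = f(1,1) + f(σ,σ)`
    rw [hcc, map_add]
    calc f.1 (σ, σ) + f.1 (σ, σ)
        = (X.ρ σ (f.1 (σ, σ)) + X.ρ σ (f.1 (1, 1))) - f.1 (1, 1) + f.1 (σ, σ) := by rw [hcyc]; abel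
      _ = X.ρ σ (f.1 (σ, σ)) + X.ρ σ (f.1 (1, 1)) - (f.1 (1, 1) + f.1 (1, 1)) +
            (f.1 (σ, σ) + f.1 (1, 1)) := by abel

/-- **Odd torsion of `H²(G, X)` vanishes for a group of order `≤ 2`**: if `n` is odd and `n · x = 0` then
`x = 0` (`2 · x = 0` and `gcd(2, n) = 1`). [cite: SerreGaloisCohomology1997, I §2.4] -/
theorem eq_zero_of_odd_nsmul_continuousCohomology_two_of_natCard_le_two [Finite G] (hG : Nat.card G ≤ 2)
    (X : TopRep.{v} R G) {n : ℕ} (hn : Odd n) (x : continuousCohomology 2 X) (hx : n • x = 0) :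
    x = 0 := by
  have h := _root_.gcd_nsmul_eq_zero.2
    ⟨two_nsmul_continuousCohomology_two_eq_zero_of_natCard_le_two hG X x, hx⟩
  rwa [Nat.Coprime.gcd_eq_one (Nat.coprime_two_left.mpr hn), one_nsmul] at h

/-- **`H²(G, X) = 0` for the trivial group** (any topological representation `X`): a continuous `2`-cocycle `f`
on `G = 1` is the coboundary of the constant `1`-cochain `b ≡ f(1, 1)` (`(db)(1, 1) = 1·b − b + b = f(1, 1)`).  At a
COMPLEX place `w` of a number field `Γ_{K_w}` is trivial, so `H²(K_w, ·) = 0` there.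
[cite: SerreGaloisCohomology1997, I §2.3] -/
theorem continuousCohomology_two_eq_zero_of_subsingleton [Subsingleton G] (X : TopRep.{v} R G)
    (x : continuousCohomology 2 X) : x = 0 := by
  haveI : Finite G := Finite.of_subsingleton
  haveI : CompactSpace G := Finite.compactSpace
  obtain ⟨f, rfl⟩ := twoCocycleClass_surjective X x
  rw [twoCocycleClass_eq_zero_iff]
  refine ⟨⟨fun _ => f.1 (1, 1), continuous_const⟩, fun σ τ => ?_⟩
  obtain rfl : σ = 1 := Subsingleton.elim σ 1
  obtain rfl : τ = 1 := Subsingleton.elim τ 1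
  change f.1 (1, 1) = X.ρ 1 (f.1 (1, 1)) - f.1 (1, 1) + f.1 (1, 1)
  rw [_root_.map_one X.ρ, sub_add_cancel]
  rfl

end OrderTwo

/-! ## Archimedean places -/

section InfinitePlace

variable {R : Type u} [CommRing R] [TopologicalSpace R]
variable {K : Type v} [Field K]

/-- **`2 · H²(K_w, X) = 0` at an infinite place `w`**, for every topological `Γ_{K_w}`-module `X`
(`Γ_{K_w} = Gal(ℂ/K_w)` has order `≤ 2`). Milne, *ADT*, I Rem. 3.7 (the groups `H^r(ℝ, ·)` are killed by `2`).
[cite: SerreGaloisCohomology1997, I §2.4] [cite: MilneADT2006, Ch. I, Rem. 3.7] -/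
theorem two_nsmul_continuousCohomology_two_infinitePlace_eq_zero (w : InfinitePlace K)
    (X : TopRep.{v} R (absoluteGaloisGroup w.Completion)) (x : continuousCohomology 2 X) :
    2 • x = 0 := by
  haveI := finite_absoluteGaloisGroup_completion_infinitePlace w
  exact two_nsmul_continuousCohomology_two_eq_zero_of_natCard_le_two
    (natCard_absoluteGaloisGroup_completion_infinitePlace_le_two w) X x

/-- **Odd-torsion classes of `H²(K_w, X)` vanish at an infinite place `w`.**
[cite: SerreGaloisCohomology1997, I §2.4] -/
theorem eq_zero_of_odd_nsmul_eq_zero_two_infinitePlace (w : InfinitePlace K)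
    (X : TopRep.{v} R (absoluteGaloisGroup w.Completion)) {n : ℕ} (hn : Odd n)
    (x : continuousCohomology 2 X) (hx : n • x = 0) : x = 0 := by
  haveI := finite_absoluteGaloisGroup_completion_infinitePlace w
  exact eq_zero_of_odd_nsmul_continuousCohomology_two_of_natCard_le_two
    (natCard_absoluteGaloisGroup_completion_infinitePlace_le_two w) X hn x hx

variable [NumberField K] {M : Type v} [AddCommGroup M] [TopologicalSpace M] [DiscreteTopology M]

/-- **`2 · H²(K_w, M) = 0`** for the local Galois cohomology of a discrete `Γ_K`-module `M` at the infinite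
place `Sum.inl w` of a number field (`DiscreteGaloisModule.toLocal`). [cite: MilneADT2006, Ch. I, Rem. 3.7] -/
theorem two_nsmul_galoisCohomology_two_toLocal_inl_eq_zero (ρ : DiscreteGaloisModule K M)
    (w : InfinitePlace K) (x : galoisCohomology (ρ.toLocal (Sum.inl w)) 2) : 2 • x = 0 :=
  two_nsmul_continuousCohomology_two_infinitePlace_eq_zero w _ x

/-- **Odd-torsion classes of `H²(K_w, M)` vanish** at the infinite place `Sum.inl w` of a number field.
[cite: MilneADT2006, Ch. I, Rem. 3.7] -/
theorem eq_zero_of_odd_nsmul_galoisCohomology_two_toLocal_inl (ρ : DiscreteGaloisModule K M)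
    (w : InfinitePlace K) {n : ℕ} (hn : Odd n) (x : galoisCohomology (ρ.toLocal (Sum.inl w)) 2)
    (hx : n • x = 0) : x = 0 :=
  eq_zero_of_odd_nsmul_eq_zero_two_infinitePlace w _ hn x hx

/-- **`H²(K_w, M) = 0` at an infinite place for a discrete `Γ_K`-module killed by an ODD integer `n`** (e.g.
`M = E[p^k]`, `p` odd): every class is killed by `n` (`nsmul_continuousCohomology_two_eq_zero_of_forall`) and by
`2`. So at odd primes the archimedean places impose no condition in degree `2`.
[cite: MilneADT2006, Ch. I, Rem. 3.7] [cite: SerreGaloisCohomology1997, I §2.4] -/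
theorem galoisCohomology_two_toLocal_inl_eq_zero_of_odd (ρ : DiscreteGaloisModule K M)
    (w : InfinitePlace K) {n : ℕ} (hn : Odd n) (hM : ∀ m : M, n • m = 0)
    (x : galoisCohomology (ρ.toLocal (Sum.inl w)) 2) : x = 0 := by
  haveI : CompactSpace (absoluteGaloisGroup (Place.Completion (Sum.inl w : Place K))) :=
    absoluteGaloisGroup_compactSpace _
  exact eq_zero_of_odd_nsmul_galoisCohomology_two_toLocal_inl ρ w hn x
    (nsmul_continuousCohomology_two_eq_zero_of_forall _ (fun m => hM m) x)

end InfinitePlace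

end Literature.NumberTheory.GaloisRepresentations

end
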